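import Summits.PneNP.PneNP.Theorems.ExpanderLinearGeneratorsColumnTwoFinal
import Summits.PneNP.PneNP.Theorems.ExpanderLinearGeneratorsExpansionForcesDepthFregeSizeEightReduction

/-!
# PneNP / ExpanderLinearGenerators — `ExpansionForcesDepthFregeSize` at column weight two,
unconditionally

Route `PneNP/ExpanderLinearGenerators`, crux stmt-PneNP-11442
(`Summit.PneNP.PneNP.Theses.ExpanderLinearGenerators.ExpansionForcesDepthFregeSize`: the expansion
SCALE law — `(r, 3ℓ/4)`-boundary expansion of an `ℓ`-sparse unsolvable system forces depth-`d`
Frege refutations of size `2^{r^ε}`, uniformly in the numbers of variables and rows). This file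
proves its conclusion for systems in which every variable occurs in at most two equations, with no
unproved hypothesis (`expansionForcesDepthFregeSize_of_colWeight_le_two`), complementing the scale
`r = n^{1-δ}` version `ColumnTwo.linearGeneratorDepthFregeHard_of_colWeight_le_two`. Two regimes:
if the system has at least `2^{r^{1/10}}` rows, the refuted formula alone is that long
(`length_add_two_le_proofSize`); otherwise all the polylogarithmic parameters of the routing
reduction (`exists_minor_in_component`) are powers of `r^{1/10}` and the reduction applies as in
the companion file.

* `expansionForcesDepthFregeSize_of_colWeight_le_two`.

References: as in `…ColumnTwoFinal`; Galesi–Itsykson–Riazanov–Sofronova, APAL 174 (2023) (the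
treewidth form of the same slice, conditional in the tree).
-/

namespace Summit.PneNP.PneNP.Theorems.ColumnTwo

open Filter Finset Literature.Computability.MetaComplexity
open Literature.Computability.MetaComplexity.TextbookFrege
open Literature.Computability.Complexity (PropForm Clause CNF Literal)
open Literature.Computability.MetaComplexity.KrajicekRamsey (clauseOf)
open Summit.PneNP.PneNP.Theorems.GridRouting

/-- **The eventual inequalities in the scale** (`ρ = ⌊r⌋`, `kg = ⌊ρ^{1/10}⌋`). [folklore] -/
theorem eventually_params_scale {ε₀ : ℝ} (hε₀ : 0 < ε₀) (K₁ T : ℕ) :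
    ∀ᶠ ρ : ℕ in atTop, 3 ≤ ρ ∧
      10 ^ 11 * (⌊(ρ : ℝ) ^ (1 / 10 : ℝ)⌋₊ + 3) ^ 9 ≤ ρ ∧
      K₁ ≤ ⌊(ρ : ℝ) ^ (1 / 10 : ℝ)⌋₊ ∧
      227 * (ρ : ℝ) ≤ 144 * (2 : ℝ) ^ ((ρ : ℝ) ^ (ε₀ / 20)) ∧
      (T : ℝ) * 288 ^ 3 < (2 : ℝ) ^ ((ρ : ℝ) ^ (ε₀ / 20)) ∧
      4 * (ρ : ℝ) ^ (ε₀ / 20) < ((⌊(ρ : ℝ) ^ (1 / 10 : ℝ)⌋₊ : ℕ) : ℝ) ^ ε₀ := by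
  have h10 : (0 : ℝ) < 1 / 10 := by norm_num
  have hε : 0 < ε₀ / 20 := by positivity
  -- the volume: `10^11 (kg+3)^9 ≤ 10^11 (2 ρ^{1/10})^9 = 512·10^11 ρ^{9/10} ≤ ρ`
  have e1 : ∀ᶠ ρ : ℕ in atTop, (512 * 10 ^ 11 : ℝ) ≤ (ρ : ℝ) ^ (1 / 10 : ℝ) :=
    ((tendsto_rpow_atTop h10).comp tendsto_natCast_atTop_atTop).eventually_ge_atTop _
  have e2 : ∀ᶠ ρ : ℕ in atTop, (max K₁ 3 : ℝ) ≤ (ρ : ℝ) ^ (1 / 10 : ℝ) :=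
    ((tendsto_rpow_atTop h10).comp tendsto_natCast_atTop_atTop).eventually_ge_atTop _
  have e3 := eventually_linear_le_two_rpow (T * 288 ^ 3) hε
  have e4 : ∀ᶠ ρ : ℕ in atTop, 4 * (2 : ℝ) ^ ε₀ + 1 ≤ (ρ : ℝ) ^ (ε₀ / 20) :=
    ((tendsto_rpow_atTop hε).comp tendsto_natCast_atTop_atTop).eventually_ge_atTop _
  filter_upwards [e1, e2, e3, e4, eventually_ge_atTop 3] with ρ h1 h2 h3 h4 h5
  have hρ0 : (0 : ℝ) ≤ ρ := Nat.cast_nonneg ρ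
  have hρpos : (0 : ℝ) < ρ := by exact_mod_cast (show 0 < ρ by omega)
  set x : ℝ := (ρ : ℝ) ^ (1 / 10 : ℝ) with hx
  have hx3 : (3 : ℝ) ≤ x := le_trans (by exact_mod_cast le_max_right K₁ 3) h2
  have hfl : x - 1 < ⌊x⌋₊ := by have := Nat.lt_floor_add_one x; linarith
  have hflle : (⌊x⌋₊ : ℝ) ≤ x := Nat.floor_le (by positivity)
  refine ⟨h5, ?_, ?_, ?_, ?_, ?_⟩
  · -- volume
    have hx10 : x ^ 10 = ρ := by
      rw [hx, ← Real.rpow_natCast, ← Real.rpow_mul hρ0]; norm_num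
    have hx9 : x ^ 9 * x = ρ := by rw [← hx10]; ring
    have hcast : ((10 ^ 11 * (⌊x⌋₊ + 3) ^ 9 : ℕ) : ℝ) = 10 ^ 11 * ((⌊x⌋₊ : ℝ) + 3) ^ 9 := by
      push_cast; ring
    have key : (10 : ℝ) ^ 11 * ((⌊x⌋₊ : ℝ) + 3) ^ 9 ≤ ρ := by
      calc (10 : ℝ) ^ 11 * ((⌊x⌋₊ : ℝ) + 3) ^ 9 ≤ (10 : ℝ) ^ 11 * (2 * x) ^ 9 := by
            gcongr; linarith
        _ = (512 * 10 ^ 11) * x ^ 9 := by ring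
        _ ≤ x * x ^ 9 := mul_le_mul_of_nonneg_right h1 (by positivity)
        _ = ρ := by rw [mul_comm, hx9]
    exact_mod_cast hcast ▸ key
  · rw [Nat.le_floor_iff (by positivity)]
    exact le_trans (by exact_mod_cast le_max_left K₁ 3) h2
  · have : (0 : ℝ) ≤ (2 : ℝ) ^ ((ρ : ℝ) ^ (ε₀ / 20)) := by positivity
    linarith [h3.1]
  · have h3' := h3.2
    push_cast at h3'
    nlinarith [Nat.cast_nonneg (α := ℝ) T]
  · have hhalf : x / 2 ≤ ⌊x⌋₊ := by linarith
    have hpos : (0 : ℝ) < x / 2 := by linarith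
    have hmono : (x / 2) ^ ε₀ ≤ ((⌊x⌋₊ : ℕ) : ℝ) ^ ε₀ := Real.rpow_le_rpow hpos.le hhalf hε₀.le
    refine lt_of_lt_of_le ?_ hmono
    rw [Real.div_rpow (by positivity) (by norm_num), hx, ← Real.rpow_mul hρ0]
    have e : 1 / 10 * ε₀ = ε₀ / 20 + ε₀ / 20 := by ring
    rw [e, Real.rpow_add hρpos, lt_div_iff₀ (by positivity)]
    have hy : (0 : ℝ) ≤ (ρ : ℝ) ^ (ε₀ / 20) := by positivity
    have h2e : (0 : ℝ) ≤ (2 : ℝ) ^ ε₀ := by positivity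
    nlinarith [mul_nonneg hy (sub_nonneg.2 h4), h4]

/-- **`ExpansionForcesDepthFregeSize` at column weight `≤ 2`, unconditionally.** For every
`ℓ ≥ 1` and depth `d` there are `ε > 0` and `R` such that for every real `r ≥ R`, every system
`E : Fin m → LinEqMod 2 n` over `𝔽₂` in which every variable occurs in at most two equations, which
is `ℓ`-sparse, whose row supports form an `(r, 3/4 · ℓ)`-boundary expander and which is unsolvable,
has no depth-`d` `textbookFrege` proof of `¬(sumEncoding 1 E)` of size `< 2^(r^ε)` — uniformly in
`n` and `m`. This is the crux `ExpansionForcesDepthFregeSize` restricted by the one extra hypothesis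
`hcol`. [Krajíček 2019, Problem 19.4.5; Ben-Sasson–Wigderson 2001, §6; Urquhart–Fu 1996;
Ben-Sasson 2002; Krivelevich 2018; Krivelevich–Sudakov 2009] -/
theorem expansionForcesDepthFregeSize_of_colWeight_le_two :
    ∀ (ℓ d : ℕ), 1 ≤ ℓ → ∃ ε : ℝ, 0 < ε ∧ ∃ R : ℝ, ∀ r : ℝ, R ≤ r →
      ∀ (n m : ℕ) (E : Fin m → LinEqMod 2 n),
      (∀ j : Fin n, (Finset.univ.filter fun i => j ∈ (E i).supp).card ≤ 2) →
      (∀ i, (E i).supp.card ≤ ℓ) →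
      IsBoundaryExpander (fun i => (E i).supp.map Fin.valEmbedding) r (3 / 4 * ℓ) →
      ¬ SystemSat E Finset.univ →
      ∀ π : List (PropForm ℕ),
        textbookFrege.IsDepthProofOf d π (PropForm.neg (PropForm.ofCNF (sumEncoding 1 E))) →
          (2 : ℝ) ^ (r ^ ε) ≤ (proofSize π : ℝ) := by
  intro ℓ d hℓ
  obtain ⟨ε₀, hε₀, K₁, hK₁⟩ := gridTseitin_depthFrege_lowerBound (d + 3 * 4 + 16)
  obtain ⟨N, hN⟩ := eventually_atTop.1 (eventually_params_scale hε₀ K₁ transferConst)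
  set ε : ℝ := min (ε₀ / 40) (1 / 20) with hεdef
  have hεpos : 0 < ε := lt_min (by positivity) (by norm_num)
  have hε40 : ε ≤ ε₀ / 40 := min_le_left _ _
  have hε20 : ε ≤ 1 / 20 := min_le_right _ _
  refine ⟨ε, hεpos, (N : ℝ) + 3, ?_⟩
  intro r hr n m E hcol hsparse hexp hunsat π hπ
  classical
  set ρ : ℕ := ⌊r⌋₊ with hρ
  have hr3 : (3 : ℝ) ≤ r := le_trans (by have := Nat.cast_nonneg (α := ℝ) N; linarith) hr
  have hr1 : (1 : ℝ) ≤ r := by linarith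
  have hρr : (ρ : ℝ) ≤ r := Nat.floor_le (by linarith)
  have hrρ : r < ρ + 1 := Nat.lt_floor_add_one r
  have hNρ : N ≤ ρ := by
    rw [hρ, Nat.le_floor_iff (by linarith)]; linarith
  obtain ⟨hρ3, hvol0, hK₁k, h227, hT3, hk4⟩ := hN ρ hNρ
  set kg : ℕ := ⌊(ρ : ℝ) ^ (1 / 10 : ℝ)⌋₊ with hkg
  set S : Fin m → Finset ℕ := fun i => (E i).supp.map Fin.valEmbedding with hS
  -- nonempty rows
  have hc : (0 : ℝ) < 3 / 4 * ℓ := mul_pos (by norm_num) (by exact_mod_cast hℓ)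
  have hdeg : ∀ i, 0 < (E i).supp.card := fun i => by
    have := hexp.card_pos hc hr1 i
    rwa [Finset.card_map] at this
  have hsize0 : m + 2 ≤ proofSize π :=
    (Nat.add_le_add_right (card_le_length_sumEncoding E fun i => Finset.card_pos.1 (hdeg i)) 2).trans
      (length_add_two_le_proofSize hπ.1)
  have hρ1 : (1 : ℝ) ≤ ρ := by exact_mod_cast (show 1 ≤ ρ by omega)
  -- the large-`m` regime: the refuted formula alone is long
  by_cases hbig : (2 : ℝ) ^ (r ^ (1 / 10 : ℝ)) ≤ m
  · calc (2 : ℝ) ^ (r ^ ε) ≤ (2 : ℝ) ^ (r ^ (1 / 10 : ℝ)) := by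
          refine Real.rpow_le_rpow_of_exponent_le one_le_two ?_
          exact Real.rpow_le_rpow_of_exponent_le hr1 (by linarith)
      _ ≤ m := hbig
      _ ≤ proofSize π := by exact_mod_cast (show m ≤ proofSize π by omega)
  push Not at hbig
  -- the small-`m` regime: the routing reduction at scale `ρ`
  set Λ : ℕ := Nat.log 2 m + 1 with hΛ
  have hm1 : 1 ≤ m := by
    by_contra h
    push Not at h
    have : m = 0 := by omega
    subst this
    exact hunsat ⟨fun _ => 0, fun i => i.elim0⟩
  have hmΛ : m < 2 ^ Λ := Nat.lt_pow_succ_log_self one_lt_two m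
  have hΛm : 2 ^ (Λ - 1) ≤ m := by
    rw [hΛ, Nat.add_sub_cancel]; exact Nat.pow_log_le_self 2 (by omega)
  -- `Λ ≤ kg + 3`
  have hΛkg : Λ ≤ kg + 3 := by
    have h1 : ((2 : ℕ) : ℝ) ^ (Λ - 1) ≤ m := by exact_mod_cast hΛm
    have h2 : ((2 : ℕ) : ℝ) ^ (Λ - 1) < (2 : ℝ) ^ (r ^ (1 / 10 : ℝ)) := lt_of_le_of_lt h1 hbig
    have h3 : ((Λ - 1 : ℕ) : ℝ) < r ^ (1 / 10 : ℝ) := by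
      have := h2
      rw [show ((2 : ℕ) : ℝ) ^ (Λ - 1) = (2 : ℝ) ^ (((Λ - 1 : ℕ) : ℝ)) by
        rw [Real.rpow_natCast]; norm_num] at this
      exact (Real.rpow_lt_rpow_left_iff one_lt_two).1 this
    -- `r^{1/10} ≤ (ρ+1)^{1/10} ≤ ρ^{1/10} + 1 < kg + 2`
    have h4 : r ^ (1 / 10 : ℝ) ≤ (ρ : ℝ) ^ (1 / 10 : ℝ) + 1 := by
      have h41 : r ^ (1 / 10 : ℝ) ≤ ((ρ : ℝ) + 1) ^ (1 / 10 : ℝ) :=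
        Real.rpow_le_rpow (by linarith) hrρ.le (by norm_num)
      have h42 : ((ρ : ℝ) + 1) ^ (1 / 10 : ℝ) ≤ (ρ : ℝ) ^ (1 / 10 : ℝ) + 1 ^ (1 / 10 : ℝ) :=
        Real.rpow_add_le_add_rpow (Nat.cast_nonneg ρ) zero_le_one (by norm_num) (by norm_num)
      rw [Real.one_rpow] at h42
      linarith
    have h5 : (ρ : ℝ) ^ (1 / 10 : ℝ) < kg + 1 := by
      have := Nat.lt_floor_add_one ((ρ : ℝ) ^ (1 / 10 : ℝ)); simpa [hkg] using this
    have h6 : ((Λ - 1 : ℕ) : ℝ) < (kg : ℝ) + 2 := by linarith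
    have h7 : (Λ - 1 : ℕ) < kg + 2 := by exact_mod_cast h6
    omega
  have hΛ1 : 1 ≤ Λ := by rw [hΛ]; omega
  -- parameters
  set Kx : ℕ := 1000 * Λ * (Λ + 1) with hKx
  set s : ℕ := 2 * Kx * Λ with hs
  set t : ℕ := 4 * (Nat.log 2 ρ + 1) with ht
  set L : ℕ := 2 * (s + 1) + 2 * (t + 1) with hL
  set M : ℕ := nRows kg with hM
  set p : ℕ := 6 * M with hp
  set q : ℕ := 8 * p * L with hq
  have hKx1 : 1 ≤ Kx := by
    rw [hKx]
    refine Nat.one_le_iff_ne_zero.2 ?_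
    simp only [ne_eq, Nat.mul_eq_zero, not_or]
    omega
  have hM1 : 1 ≤ M := (nRows_bounds kg).2.2.2.1
  -- an odd closed component, of more than `ρ` rows, hence `m > ρ`
  have hcw := coverDegree_le_two_of_col E hcol
  obtain ⟨K₀, hK₀ne, hK₀c, hK₀b, -⟩ := exists_odd_closed_of_not_systemSat E hcol hunsat
  have hℓ' : ∀ i, (S i).card ≤ ℓ := fun i => by simp only [hS, Finset.card_map]; exact hsparse i
  have hρK : ρ < K₀.card := by
    by_contra hle
    push Not at hle
    have h1 := three_mul_sum_le hℓ' hexp (le_trans (by exact_mod_cast hle) hρr)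
    rw [hK₀b, Finset.card_empty, mul_zero] at h1
    obtain ⟨i, hi⟩ := hK₀ne
    have h2 : (S i).card ≤ ∑ j ∈ K₀, (S j).card :=
      Finset.single_le_sum (f := fun j => (S j).card) (fun j _ => Nat.zero_le _) hi
    have h3 : 0 < (S i).card := by simp only [hS, Finset.card_map]; exact hdeg i
    omega
  have hρm : ρ < m := lt_of_lt_of_le hρK ((Finset.card_le_univ K₀).trans (by simp))
  have hlogr : Nat.log 2 ρ + 1 ≤ Λ := by
    rw [hΛ]; exact Nat.succ_le_succ (Nat.log_mono_right hρm.le)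
  have hvol : (12 * Kx + 3) * (p * q + p * p * L) + 3 ≤ ρ := by
    refine (vol_le hΛ1 hlogr rfl rfl rfl rfl rfl rfl).trans (le_trans ?_ hvol0)
    calc 10 ^ 11 * Λ ^ 5 * (kg + 3) ^ 4 ≤ 10 ^ 11 * (kg + 3) ^ 5 * (kg + 3) ^ 4 := by gcongr
      _ = 10 ^ 11 * (kg + 3) ^ 9 := by ring
  have hsrad : (2 * Kx) ^ s * m < (2 * Kx + 1) ^ s := linking_radius hKx1 hmΛ
  -- the minors, the substitution, the transfer
  have hemb : ∀ K : Finset (Fin m), K.Nonempty → IsConn S K → boundary S K = ∅ →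
      ∑ i ∈ K, (E i).2 = 1 → ∃ T : Fin M → Finset (Fin m),
        (∀ a, T a ⊆ K ∧ IsConn S (T a) ∧ (T a).Nonempty) ∧ (∀ a b, a ≠ b → Disjoint (T a) (T b)) ∧
        (∀ a b, a ≠ b → ((gridSystem kg a).supp ∩ (gridSystem kg b).supp).Nonempty →
          ∃ i ∈ T a, ∃ j ∈ T b, (S i ∩ S j).Nonempty) := by
    intro K hKne hKc hKb _
    obtain ⟨T, hT1, hT2, hT3⟩ := exists_minor_in_component E hcol hsparse hℓ hexp hρr hr1 hmΛ hKne
      hKc hKb (four_pow_mul_lt ρ) hsrad rfl rfl hM1 hvol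
    exact ⟨T, hT1, hT2, fun a b hab _ => hT3 a b hab⟩
  obtain ⟨σ, hZ, hT, hloc⟩ := exists_routing_subst E (gridSystem kg) (k₀ := 4) hcol
    (card_filter_mem_supp_gridSystem (k := kg)) (card_supp_gridSystem_le kg) (sum_gridSystem_snd kg) hemb
  obtain ⟨π', hπ', hsize⟩ := transfer_isDepthProofOf (sumEncoding 1 E) (sumEncoding 1 (gridSystem kg))
    σ (Zσ := 9 * 2 ^ 4) (Tσ := 3 * 4) (qq := 2 ^ 4) (k := 4) hZ (by norm_num) hT hπ hloc
  have hlb := hK₁ kg hK₁k π' hπ'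
  have hms := msum_gridClauses_le (k := kg)
  have hsz : proofSize π' ≤ transferConst * (144 * proofSize π + 224 * M + 3) ^ 3 := by
    refine hsize.trans ?_
    have h1 : transferLines (proofSize π) (proofSize π * (9 * 2 ^ 4) +
        msum ((sumEncoding 1 (gridSystem kg)).map clauseOf)) (2 ^ 4) 4 ≤
        transferLines (144 * proofSize π) (144 * proofSize π + 224 * M) 16 4 := by
      rw [show (2 ^ 4 : ℕ) = 16 by norm_num]
      exact transferLines_mono (by omega) (by omega)
    have h2 : 40 * ((2 ^ 4 + 3) * (proofSize π * (9 * 2 ^ 4) +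
        msum ((sumEncoding 1 (gridSystem kg)).map clauseOf) + 3) + 4) + 300 ≤
        40 * (19 * (144 * proofSize π + 224 * M + 3) + 4) + 300 := by
      norm_num
      omega
    exact (Nat.mul_le_mul h1 h2).trans (transferBound_le' (144 * proofSize π) M)
  have hMρ : M ≤ ρ := by
    have h1 : M ≤ (kg + 3) ^ 2 := (nRows_bounds kg).1
    have h2 : (kg + 3) ^ 2 ≤ (kg + 3) ^ 9 := Nat.pow_le_pow_right (by omega) (by norm_num)
    have h3 : (kg + 3) ^ 9 ≤ 10 ^ 11 * (kg + 3) ^ 9 := Nat.le_mul_of_pos_left _ (by norm_num)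
    omega
  have hT0 : 0 < transferConst := by unfold transferConst; omega
  have key := lb_arith (ε := ε₀ / 20) hT0 hlb hsz hMρ (by omega) h227 hT3 hk4
  -- `2^{r^ε} ≤ 2^{ρ^{ε₀/20}}`: `r^ε ≤ r^{ε₀/40} ≤ (ρ²)^{ε₀/40} = ρ^{ε₀/20}` as `r ≤ ρ²`
  refine le_trans (Real.rpow_le_rpow_of_exponent_le one_le_two ?_) key
  have hρρ : ρ + 1 ≤ ρ * ρ :=
    calc ρ + 1 ≤ 3 * ρ := by omega
      _ ≤ ρ * ρ := Nat.mul_le_mul_right ρ hρ3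
  have hρρ' : (ρ : ℝ) + 1 ≤ (ρ : ℝ) * ρ := by exact_mod_cast hρρ
  have hρ2 : r ≤ (ρ : ℝ) ^ (2 : ℝ) := by
    rw [Real.rpow_two, sq]; linarith
  calc r ^ ε ≤ r ^ (ε₀ / 40) := Real.rpow_le_rpow_of_exponent_le hr1 hε40
    _ ≤ ((ρ : ℝ) ^ (2 : ℝ)) ^ (ε₀ / 40) := Real.rpow_le_rpow (by linarith) hρ2 (by positivity)
    _ = (ρ : ℝ) ^ (ε₀ / 20) := by
        rw [← Real.rpow_mul (Nat.cast_nonneg ρ)]; ring_nf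

end Summit.PneNP.PneNP.Theorems.ColumnTwo
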